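import Literature.NumberTheory.Automorphic.ContractingTransversalDistanceRegular
import Literature.NumberTheory.Automorphic.HeckeGelfandTrick

/-!
# Distance-regular Hecke neighbours ⇒ the OPERATOR recursion `[K tᵐ K] v = μ_m v` on `V^K`
# (LOCAL SEAM of s23, inert package, organ (26-n) H1 — the generic half)

Track B ∕ K2-LIT, hLiu418 = stmt-HodgeConjecture-24832; inert package of the local seam of s23 (words
`K2/K2Liu-p01/g3/INERT-SOCKETS-v2.K2Liup01g3.md`, plan `PLAN-28i-row26.K2Liup01g3.md`). Helper (count-neutral, own head per
LEAD R3), PURE GROUP THEORY: `G` a group, `K ≤ G`, `t ∈ G` with `t⁻¹ ∈ KtK`, the shells `K tⁿ K` finite modulo `K` and pairwise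
disjoint, and a transversal `X` of `KtK ∕ K` whose translates `tⁿ x K` (`x ∈ X`, `n ≥ 1`) split `c₊ ∕ c₀ ∕ 1` over the shells
`K t^{n+1} K ∕ K tⁿ K ∕ K t^{n-1} K` (the hypothesis `hreg` of ★ `SphericalCoefficient.radial_recurrence` ∕ ★ `card_orbit_pow_eq`, supplied
for CONTRACTING transversals `X = X₊ ∪ X₀ ∪ {t⁻¹}` by ★ `SphericalCoefficient.ncard_translates_of_contracting`); `ρ` ANY representation of
`G` over a commutative ring `k`, `v ∈ V^K`.

* §1 the pair count `N_{tᵐ,t}(γ) = #{α ∈ KtᵐK∕K : α⁻¹γ ∈ KtK∕K}` of ★ `heckePairCount` (the structure constants of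
  `1_{KtᵐK} * 1_{KtK}`) THROUGH THE NEIGHBOUR COUNTS: for `γ ∈ K tʲ K ∕ K`, `N_{tᵐ,t}(γ) = #{x ∈ X : tʲ x ∈ K tᵐ K}`
  (`heckePairCount_pow_eq_ncard`: symmetry of the radius-one neighbour relation from `t⁻¹ ∈ KtK`, then the bipartite count of ★
  `card_orbit_succ_eq` and ★ `neighbourCount_mul_mem` ∕ `neighbourCount_eq_ncard_transversal`), and `N_{tᵐ,t}(γ) ≠ 0 ⇒ γ` lies on one
  of the shells `m+1, m, m-1` (`m ≥ 1`);
* §2 **`heckeOperator_pow_heckeOperator_apply`** — the product formula ★ `heckeOperator_heckeOperator_apply` REGROUPED over the three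
  shells: `[KtᵐK]([KtK] v) = [Kt^{m+1}K] v + c₀·[KtᵐK] v + c·[Kt^{m-1}K] v` with `c = #X` at `m = 1` and `c = c₊` for `m ≥ 2`;
* §3 **`heckeOperator_pow_apply_eq_smul`** — if `[KtK] v = a₁ v` then `[KtᵐK] v = μ_m v` with `μ₀ = 1, μ₁ = a₁, μ₂ = a₁² − c₀a₁ − #X,
  μ_{n+3} = (a₁ − c₀)μ_{n+2} − c₊ μ_{n+1}` (two-step induction), and its CONTRACTING form **`heckeOperator_pow_apply_eq_smul_of_contracting`**
  (`c₊ = |X₊|`, `c₀ = |X₀|`, `#X = |X₊| + |X₀| + 1`, ★ `card_contractingTransversal`).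

This is the OPERATOR twin of ★ `SphericalCoefficient.radial_recurrence` (the zonal-coefficient version) — the Hecke algebra of the
semi-homogeneous tree seen from a vertex [Macdonald1971, Ch. V §3], [CartierCorvallis1979, §IV.1], [SerreTrees1980, II.1.1],
[BruhatTits1972, (4.4.4)]; for the hyperspecial `U(1,1)` at an inert place (`(c₊, c₀, #X) = (q², q−1, q²+q)`, organ (26-n) H2
`K2LiuRankOneHeckeNeighboursTwo`) it is exactly the recursion consumed by ★ `K2LiuCartanSeriesU11Closed.cartanSeriesU11_closed_form` (#28i).
Theorems only; no `sorry`; no definition. HONEST LABEL: HC_CM is proved only modulo the printed citations (2 remaining named inputs: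
hLiu418 = stmt-HodgeConjecture-24832, h413 = stmt-HodgeConjecture-24833) until rung 0 closes; this file is unconditional and moves no counter.
-/

set_option autoImplicit false

set_option linter.dupNamespace false

noncomputable section

open MulAction
open scoped Pointwise

namespace Summit.HodgeConjecture.HodgeConjecture.Cruxes.HLiu418.K2LiuHeckeShellRecursion

open Literature.NumberTheory.Automorphic Literature.NumberTheory.Automorphic.SphericalCoefficient

variable {G : Type*} [Group G] {K : Subgroup G} {t : G}

/-! ## §1 The pair count `N_{tᵐ, t}` through the radius-one neighbour counts -/

/-- The radius-one neighbour relation on representatives: `(gK)~⁻¹ (g'K)~ ∈ KtK ↔ g⁻¹ g' ∈ KtK`. [cite: CartierCorvallis1979, §IV.1] -/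
theorem out_inv_mul_out_mem_iff (g g' : G) :
    ((g : G ⧸ K).out)⁻¹ * (g' : G ⧸ K).out ∈ DoubleCoset.doubleCoset t (K : Set G) K ↔
      g⁻¹ * g' ∈ DoubleCoset.doubleCoset t (K : Set G) K := by
  obtain ⟨κ, hκ⟩ := QuotientGroup.mk_out_eq_mul K g
  obtain ⟨κ', hκ'⟩ := QuotientGroup.mk_out_eq_mul K g'
  rw [hκ, hκ', mul_inv_rev, mul_assoc, ← mul_assoc g⁻¹, ← mul_assoc, mul_mul_mem_doubleCoset_iff (K.inv_mem κ.2) κ'.2]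

/-- **Symmetry of the neighbour relation** (`t⁻¹ ∈ KtK` makes `KtK` inversion-stable): `α̃⁻¹γ̃ ∈ KtK ⇒ γ̃⁻¹α̃ ∈ KtK`.
[cite: CartierCorvallis1979, §IV.1] [cite: SerreTrees1980, II.1.1] -/
theorem out_inv_mul_out_mem_symm (hsymm : t⁻¹ ∈ DoubleCoset.doubleCoset t (K : Set G) K) {p p' : G ⧸ K}
    (h : p.out⁻¹ * p'.out ∈ DoubleCoset.doubleCoset t (K : Set G) K) :
    p'.out⁻¹ * p.out ∈ DoubleCoset.doubleCoset t (K : Set G) K := by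
  have := inv_mem_doubleCoset_of_inv_mem hsymm h
  simpa [mul_inv_rev] using this

/-- The membership test of ★ `heckePairCount` in representative form: `α̃⁻¹ • γ ∈ KtK∕K ↔ α̃⁻¹ γ̃ ∈ KtK`. [cite: CartierCorvallis1979, §IV.1] -/
theorem out_inv_smul_mem_orbit_iff (α γ : G ⧸ K) :
    α.out⁻¹ • γ ∈ orbit K (t : G ⧸ K) ↔ α.out⁻¹ * γ.out ∈ DoubleCoset.doubleCoset t (K : Set G) K := by
  rw [← MulAction.Quotient.coe_smul_out, smul_eq_mul, mk_mem_orbit_iff]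

/-- **THE PAIR COUNT THROUGH THE NEIGHBOUR COUNTS**: for `γ ∈ K tʲ K ∕ K` and a transversal `X` of `KtK∕K`,
`N_{tᵐ,t}(γ) = #{α ∈ KtᵐK∕K : α̃⁻¹γ̃ ∈ KtK} = #{x ∈ X : tʲ x ∈ K tᵐ K}` — by symmetry the left side counts the radius-one neighbours
`γ̃ x K` of `γ` on the shell `m`, and `γ̃ = k tʲ k'` is stripped by ★ `neighbourCount_mul_mem`. [cite: SerreTrees1980, II.1.1]
[cite: CartierCorvallis1979, §IV.1 Thm. 4.1] [cite: Macdonald1971, Ch. V §3] -/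
theorem heckePairCount_pow_eq_ncard (hsymm : t⁻¹ ∈ DoubleCoset.doubleCoset t (K : Set G) K)
    (O₁ : Finset (G ⧸ K)) (hO₁ : ∀ q : G ⧸ K, q ∈ O₁ ↔ q ∈ orbit K (t : G ⧸ K))
    {X : Finset G} (hX : Set.BijOn (fun y : G => (y : G ⧸ K)) X (orbit K (t : G ⧸ K)))
    (m : ℕ) {j : ℕ} {γ : G ⧸ K} (hγ : γ ∈ orbit K ((t ^ j : G) : G ⧸ K)) :
    heckePairCount K (t ^ m) t γ = {y | y ∈ X ∧ t ^ j * y ∈ DoubleCoset.doubleCoset (t ^ m) (K : Set G) K}.ncard := by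
  -- Step 1: symmetrise the membership test
  have hset : {α ∈ orbit K ((t ^ m : G) : G ⧸ K) | α.out⁻¹ • γ ∈ orbit K (t : G ⧸ K)} =
      {α | α ∈ orbit K ((t ^ m : G) : G ⧸ K) ∧ γ.out⁻¹ * α.out ∈ DoubleCoset.doubleCoset t (K : Set G) K} := by
    ext α
    simp only [Set.mem_setOf_eq, out_inv_smul_mem_orbit_iff]
    exact ⟨fun h => ⟨h.1, out_inv_mul_out_mem_symm hsymm h.2⟩, fun h => ⟨h.1, out_inv_mul_out_mem_symm hsymm h.2⟩⟩
  rw [heckePairCount, hset]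
  -- Step 2: the bijection `q ↦ (γ̃ q̃) K` from `{q ∈ O₁ : γ̃ q̃ ∈ K tᵐ K}` (adapted from ★ `card_orbit_succ_eq`)
  have himage : {α | α ∈ orbit K ((t ^ m : G) : G ⧸ K) ∧ γ.out⁻¹ * α.out ∈ DoubleCoset.doubleCoset t (K : Set G) K} =
      (fun q : G ⧸ K => ((γ.out * q.out : G) : G ⧸ K)) ''
        {q | q ∈ O₁ ∧ γ.out * q.out ∈ DoubleCoset.doubleCoset (t ^ m) (K : Set G) K} := by
    ext α
    simp only [Set.mem_setOf_eq, Set.mem_image]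
    constructor
    · rintro ⟨hα, hr⟩
      refine ⟨((γ.out⁻¹ * α.out : G) : G ⧸ K), ⟨(hO₁ _).2 ((mk_mem_orbit_iff _).2 hr), ?_⟩, ?_⟩
      · rw [mul_out_mem_doubleCoset_iff, mul_inv_cancel_left, ← mk_mem_orbit_iff, QuotientGroup.out_eq']
        exact hα
      · obtain ⟨κ, hκ⟩ := QuotientGroup.mk_out_eq_mul K (γ.out⁻¹ * α.out)
        rw [hκ, show γ.out * (γ.out⁻¹ * α.out * (κ : G)) = α.out * κ by group]
        have : ((α.out * (κ : G) : G) : G ⧸ K) = ((α.out : G) : G ⧸ K) :=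
          QuotientGroup.eq.2 (by rw [mul_inv_rev, mul_assoc, inv_mul_cancel, mul_one]; exact K.inv_mem κ.2)
        rw [this, QuotientGroup.out_eq']
    · rintro ⟨q, ⟨hq, hmem⟩, rfl⟩
      refine ⟨(mk_mem_orbit_iff _).2 hmem, ?_⟩
      have hq' : q.out ∈ DoubleCoset.doubleCoset t (K : Set G) K :=
        (mk_mem_orbit_iff _).1 (by rw [QuotientGroup.out_eq']; exact (hO₁ _).1 hq)
      have h := (out_inv_mul_out_mem_iff (K := K) (t := t) γ.out (γ.out * q.out)).2 (by rw [inv_mul_cancel_left]; exact hq')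
      rwa [QuotientGroup.out_eq'] at h
  have hinj : Set.InjOn (fun q : G ⧸ K => ((γ.out * q.out : G) : G ⧸ K))
      {q | q ∈ O₁ ∧ γ.out * q.out ∈ DoubleCoset.doubleCoset (t ^ m) (K : Set G) K} := by
    rintro q ⟨-, -⟩ q' ⟨-, -⟩ h
    have h' : ((q.out : G) : G ⧸ K) = ((q'.out : G) : G ⧸ K) := by
      rw [QuotientGroup.eq] at h ⊢; simpa [mul_inv_rev, mul_assoc] using h
    rwa [QuotientGroup.out_eq', QuotientGroup.out_eq'] at h'
  rw [himage, hinj.ncard_image]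
  -- Step 3: strip `γ̃ = k tʲ k'` and pass to the transversal
  have hγD : γ.out ∈ DoubleCoset.doubleCoset (t ^ j) (K : Set G) K :=
    (mk_mem_orbit_iff _).1 (by rw [QuotientGroup.out_eq']; exact hγ)
  obtain ⟨k₁, hk₁, k₂, hk₂, hγk⟩ := DoubleCoset.mem_doubleCoset.1 hγD
  rw [hγk, neighbourCount_mul_mem hk₁ hk₂ O₁ hO₁, neighbourCount_eq_ncard_transversal O₁ hO₁ hX]

/-- **Support of the pair count**: if `N_{tᵐ,t}(γ) ≠ 0` (`m ≥ 1`) then `γ` lies on one of the shells `K t^{m+1} K`, `K tᵐ K`,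
`K t^{m-1} K` — `γ̃ ∈ α̃·KtK = k tᵐ k'·x K` and the translates `tᵐ x` cover only these three shells. [cite: SerreTrees1980, II.1.1]
[cite: Macdonald1971, Ch. V §3] -/
theorem mem_orbit_of_heckePairCount_ne_zero {X : Finset G} (hX : Set.BijOn (fun y : G => (y : G ⧸ K)) X (orbit K (t : G ⧸ K)))
    {m : ℕ}
    (hcov : ∀ x ∈ X, t ^ m * x ∈ DoubleCoset.doubleCoset (t ^ (m + 1)) (K : Set G) K ∨
      t ^ m * x ∈ DoubleCoset.doubleCoset (t ^ m) (K : Set G) K ∨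
      t ^ m * x ∈ DoubleCoset.doubleCoset (t ^ (m - 1)) (K : Set G) K)
    {γ : G ⧸ K} (h : heckePairCount K (t ^ m) t γ ≠ 0) :
    γ ∈ orbit K ((t ^ (m + 1) : G) : G ⧸ K) ∨ γ ∈ orbit K ((t ^ m : G) : G ⧸ K) ∨ γ ∈ orbit K ((t ^ (m - 1) : G) : G ⧸ K) := by
  obtain ⟨α, hα, hαγ⟩ := Set.nonempty_of_ncard_ne_zero h
  rw [out_inv_smul_mem_orbit_iff] at hαγ
  -- `α̃⁻¹ γ̃ K = x K` with `x ∈ X`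
  obtain ⟨x, hx, hxe⟩ := hX.surjOn ((mk_mem_orbit_iff _).2 hαγ)
  have hκ : x⁻¹ * (α.out⁻¹ * γ.out) ∈ K := QuotientGroup.eq.1 hxe
  -- `α̃ = k₁ tᵐ k₂`
  have hαD : α.out ∈ DoubleCoset.doubleCoset (t ^ m) (K : Set G) K :=
    (mk_mem_orbit_iff _).1 (by rw [QuotientGroup.out_eq']; exact hα)
  obtain ⟨k₁, hk₁, k₂, hk₂, hαk⟩ := DoubleCoset.mem_doubleCoset.1 hαD
  -- `k₂ x K = x' K` with `x' ∈ X`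
  have hxD : x ∈ DoubleCoset.doubleCoset t (K : Set G) K := (mk_mem_orbit_iff _).1 (hX.mapsTo hx)
  have hk₂x : k₂ * x ∈ DoubleCoset.doubleCoset t (K : Set G) K := by
    have := mul_mul_mem_doubleCoset hxD hk₂ K.one_mem; rwa [mul_one] at this
  obtain ⟨x', hx', hx'e⟩ := hX.surjOn ((mk_mem_orbit_iff _).2 hk₂x)
  have hκ' : x'⁻¹ * (k₂ * x) ∈ K := QuotientGroup.eq.1 hx'e
  -- `γ̃ = k₁ (tᵐ x') (x'⁻¹ k₂ x)(x⁻¹ α̃⁻¹ γ̃)`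
  have hγeq : γ.out = k₁ * (t ^ m * x') * ((x'⁻¹ * (k₂ * x)) * (x⁻¹ * (α.out⁻¹ * γ.out))) := by
    rw [hαk]; group
  have key : ∀ {s : G}, t ^ m * x' ∈ DoubleCoset.doubleCoset s (K : Set G) K → γ ∈ orbit K (s : G ⧸ K) := fun hs => by
    rw [← QuotientGroup.out_eq' γ, mk_mem_orbit_iff, hγeq]
    exact mul_mul_mem_doubleCoset hs hk₁ (K.mul_mem hκ' hκ)
  rcases hcov x' hx' with h1 | h2 | h3
  · exact Or.inl (key h1)
  · exact Or.inr (Or.inl (key h2))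
  · exact Or.inr (Or.inr (key h3))

/-! ## §2 The product `[K tᵐ K]∘[K t K]` on `V^K`, regrouped over the three shells -/

section Operator

variable {k V : Type*} [CommRing k] [AddCommGroup V] [Module k V] (ρ : Representation k G V)

/-- Two shells with different exponents give disjoint finite orbit sets. [cite: BruhatTits1972, (4.4.3)] -/
theorem disjoint_toFinset_of_ne (hfin : ∀ n : ℕ, (orbit K ((t ^ n : G) : G ⧸ K)).Finite)
    (hD : ∀ m n : ℕ, m ≠ n → Disjoint (DoubleCoset.doubleCoset (t ^ m) (K : Set G) K) (DoubleCoset.doubleCoset (t ^ n) (K : Set G) K))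
    {i j : ℕ} (hij : i ≠ j) : Disjoint (hfin i).toFinset (hfin j).toFinset := by
  rw [Finset.disjoint_left]
  intro q hi hj
  rw [Set.Finite.mem_toFinset, ← QuotientGroup.out_eq' q, mk_mem_orbit_iff] at hi hj
  exact Set.disjoint_left.1 (hD i j hij) hi hj

/-- A sum of `c • ρ(γ̃) v` over a shell is `c • [K tʲ K] v`. [cite: CartierCorvallis1979, §IV.1] -/
theorem sum_toFinset_const_smul (hfin : ∀ n : ℕ, (orbit K ((t ^ n : G) : G ⧸ K)).Finite) {v : V} (hv : v ∈ ρ.fixedPoints K)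
    (j : ℕ) (c : k) :
    ∑ γ ∈ (hfin j).toFinset, c • ρ γ.out v = c • heckeOperator ρ K (t ^ j) v := by
  rw [heckeOperator_apply_eq_sum_out ρ K (t ^ j) (hfin j) hv, Finset.smul_sum]

/-- **`[K tᵐ K]([K t K] v) = [K t^{m+1} K] v + c₀ • [K tᵐ K] v + c • [K t^{m-1} K] v`** on `V^K` (`m ≥ 1`; `c = #X` for `m = 1`, `c = c₊`
for `m ≥ 2`), for shells with radius-one neighbour counts `c₊ ∕ c₀ ∕ 1`: the product formula ★ `heckeOperator_heckeOperator_apply` with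
its pair count evaluated by `heckePairCount_pow_eq_ncard`. [cite: Macdonald1971, Ch. V §3] [cite: SerreTrees1980, II.1.1]
[cite: CartierCorvallis1979, §IV.1 Thm. 4.1] -/
theorem heckeOperator_pow_heckeOperator_apply (hfin : ∀ n : ℕ, (orbit K ((t ^ n : G) : G ⧸ K)).Finite)
    (hsymm : t⁻¹ ∈ DoubleCoset.doubleCoset t (K : Set G) K)
    (hD : ∀ m n : ℕ, m ≠ n → Disjoint (DoubleCoset.doubleCoset (t ^ m) (K : Set G) K) (DoubleCoset.doubleCoset (t ^ n) (K : Set G) K))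
    {X : Finset G} (hX : Set.BijOn (fun y : G => (y : G ⧸ K)) X (orbit K (t : G ⧸ K))) {cup c0 : ℕ}
    (hreg : ∀ n, 1 ≤ n →
      {y | y ∈ X ∧ t ^ n * y ∈ DoubleCoset.doubleCoset (t ^ (n + 1)) (K : Set G) K}.ncard = cup ∧
      {y | y ∈ X ∧ t ^ n * y ∈ DoubleCoset.doubleCoset (t ^ n) (K : Set G) K}.ncard = c0 ∧
      {y | y ∈ X ∧ t ^ n * y ∈ DoubleCoset.doubleCoset (t ^ (n - 1)) (K : Set G) K}.ncard = 1 ∧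
      ∀ y ∈ X, t ^ n * y ∈ DoubleCoset.doubleCoset (t ^ (n + 1)) (K : Set G) K ∨
        t ^ n * y ∈ DoubleCoset.doubleCoset (t ^ n) (K : Set G) K ∨
        t ^ n * y ∈ DoubleCoset.doubleCoset (t ^ (n - 1)) (K : Set G) K)
    {v : V} (hv : v ∈ ρ.fixedPoints K) {m : ℕ} (hm : 1 ≤ m) :
    heckeOperator ρ K (t ^ m) (heckeOperator ρ K t v) =
      heckeOperator ρ K (t ^ (m + 1)) v + (c0 : k) • heckeOperator ρ K (t ^ m) v +
        ((if m = 1 then X.card else cup : ℕ) : k) • heckeOperator ρ K (t ^ (m - 1)) v := by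
  classical
  have hfin1 : (orbit K (t : G ⧸ K)).Finite := by have h := hfin 1; rwa [pow_one] at h
  have hO₁ : ∀ q : G ⧸ K, q ∈ hfin1.toFinset ↔ q ∈ orbit K (t : G ⧸ K) := fun q => Set.Finite.mem_toFinset _
  rw [heckeOperator_heckeOperator_apply ρ K (t ^ m) t (hfin m) hfin1 hv]
  -- the support lies in the three shells
  set T : Finset (G ⧸ K) := (hfin (m + 1)).toFinset ∪ (hfin m).toFinset ∪ (hfin (m - 1)).toFinset with hT
  have hcov := (hreg m hm).2.2.2
  rw [finsum_eq_sum_of_support_subset _ (s := T) (fun γ hγ => by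
    have hne : heckePairCount K (t ^ m) t γ ≠ 0 := fun h0 => by
      apply hγ
      change ((heckePairCount K (t ^ m) t γ : ℕ) : k) • ρ γ.out v = 0
      rw [h0, Nat.cast_zero, zero_smul]
    simp only [hT, Finset.coe_union, Set.Finite.coe_toFinset, Set.mem_union]
    rcases mem_orbit_of_heckePairCount_ne_zero hX hcov hne with h | h | h
    · exact Or.inl (Or.inl h)
    · exact Or.inl (Or.inr h)
    · exact Or.inr h)]
  -- split the sum over the three (pairwise disjoint) shells
  have hne1 : m + 1 ≠ m := Nat.succ_ne_self m
  have hne2 : m + 1 ≠ m - 1 := by omega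
  have hne3 : m ≠ m - 1 := by omega
  have hd12 : Disjoint ((hfin (m + 1)).toFinset ∪ (hfin m).toFinset) (hfin (m - 1)).toFinset := by
    rw [Finset.disjoint_union_left]
    exact ⟨disjoint_toFinset_of_ne hfin hD hne2, disjoint_toFinset_of_ne hfin hD hne3⟩
  rw [hT, Finset.sum_union hd12, Finset.sum_union (disjoint_toFinset_of_ne hfin hD hne1)]
  -- evaluate the pair count on each shell
  have hval : ∀ {j : ℕ} {c : ℕ}, {y | y ∈ X ∧ t ^ j * y ∈ DoubleCoset.doubleCoset (t ^ m) (K : Set G) K}.ncard = c →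
      ∑ γ ∈ (hfin j).toFinset, (heckePairCount K (t ^ m) t γ : k) • ρ γ.out v = (c : k) • heckeOperator ρ K (t ^ j) v := by
    intro j c hc
    rw [← sum_toFinset_const_smul ρ hfin hv j (c : k)]
    refine Finset.sum_congr rfl fun γ hγ => ?_
    rw [heckePairCount_pow_eq_ncard hsymm _ hO₁ hX m ((Set.Finite.mem_toFinset _).1 hγ), hc]
  -- shell `m + 1`: one neighbour below
  have hdown : {y | y ∈ X ∧ t ^ (m + 1) * y ∈ DoubleCoset.doubleCoset (t ^ m) (K : Set G) K}.ncard = 1 := by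
    have h := (hreg (m + 1) (by omega)).2.2.1
    rwa [Nat.add_sub_cancel] at h
  -- shell `m`: `c₀` neighbours on the same shell
  have hstay : {y | y ∈ X ∧ t ^ m * y ∈ DoubleCoset.doubleCoset (t ^ m) (K : Set G) K}.ncard = c0 := (hreg m hm).2.1
  -- shell `m - 1`: `#X` neighbours above if `m = 1`, `c₊` if `m ≥ 2`
  have hup : {y | y ∈ X ∧ t ^ (m - 1) * y ∈ DoubleCoset.doubleCoset (t ^ m) (K : Set G) K}.ncard = (if m = 1 then X.card else cup) := by
    split_ifs with h1
    · subst h1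
      rw [← Set.ncard_coe_finset]
      congr 1
      ext y
      simp only [Set.mem_setOf_eq, Finset.mem_coe, Nat.sub_self, pow_zero, one_mul, pow_one, and_iff_left_iff_imp]
      exact fun hy => (mk_mem_orbit_iff y).1 (hX.mapsTo hy)
    · have h := (hreg (m - 1) (by omega)).1
      rwa [show m - 1 + 1 = m by omega] at h
  rw [hval hdown, hval hstay, hval hup, Nat.cast_one, one_smul]

/-! ## §3 The recursion `[K tᵐ K] v = μ_m v` -/

/-- **DISTANCE-REGULAR HECKE NEIGHBOURS ⇒ THE OPERATOR RECURSION.**  With `(G, K, t, X)` as in `heckeOperator_pow_heckeOperator_apply`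
(neighbour counts `c₊ ∕ c₀ ∕ 1` for every `n ≥ 1`) and `v ∈ V^K` with `[KtK] v = a₁ v`: `[K tᵐ K] v = μ_m v` for every sequence `μ` with
`μ₀ = 1`, `μ₁ = a₁`, `μ₂ = a₁² − c₀ a₁ − #X`, `μ_{n+3} = (a₁ − c₀) μ_{n+2} − c₊ μ_{n+1}`.  For the `(q+1)`-regular tree at even distance
(`(c₊, c₀, #X) = (q², q−1, q²+q)`): `μ₂ = (a₁−q+1)a₁ − q(q+1)`, `μ_{n+3} = (a₁−q+1)μ_{n+2} − q²μ_{n+1}`. [cite: Macdonald1971, Ch. V §3 (3.9)]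
[cite: CartierCorvallis1979, §IV.1 Thm. 4.1] [cite: SerreTrees1980, II.1.1] -/
theorem heckeOperator_pow_apply_eq_smul (hfin : ∀ n : ℕ, (orbit K ((t ^ n : G) : G ⧸ K)).Finite)
    (hsymm : t⁻¹ ∈ DoubleCoset.doubleCoset t (K : Set G) K)
    (hD : ∀ m n : ℕ, m ≠ n → Disjoint (DoubleCoset.doubleCoset (t ^ m) (K : Set G) K) (DoubleCoset.doubleCoset (t ^ n) (K : Set G) K))
    {X : Finset G} (hX : Set.BijOn (fun y : G => (y : G ⧸ K)) X (orbit K (t : G ⧸ K))) {cup c0 : ℕ}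
    (hreg : ∀ n, 1 ≤ n →
      {y | y ∈ X ∧ t ^ n * y ∈ DoubleCoset.doubleCoset (t ^ (n + 1)) (K : Set G) K}.ncard = cup ∧
      {y | y ∈ X ∧ t ^ n * y ∈ DoubleCoset.doubleCoset (t ^ n) (K : Set G) K}.ncard = c0 ∧
      {y | y ∈ X ∧ t ^ n * y ∈ DoubleCoset.doubleCoset (t ^ (n - 1)) (K : Set G) K}.ncard = 1 ∧
      ∀ y ∈ X, t ^ n * y ∈ DoubleCoset.doubleCoset (t ^ (n + 1)) (K : Set G) K ∨
        t ^ n * y ∈ DoubleCoset.doubleCoset (t ^ n) (K : Set G) K ∨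
        t ^ n * y ∈ DoubleCoset.doubleCoset (t ^ (n - 1)) (K : Set G) K)
    {v : V} (hv : v ∈ ρ.fixedPoints K) {a₁ : k} (hT : heckeOperator ρ K t v = a₁ • v)
    (μ : ℕ → k) (h0 : μ 0 = 1) (h1 : μ 1 = a₁) (h2 : μ 2 = a₁ * a₁ - (c0 : k) * a₁ - (X.card : k))
    (hrec : ∀ n, μ (n + 3) = (a₁ - c0) * μ (n + 2) - (cup : k) * μ (n + 1)) (m : ℕ) :
    heckeOperator ρ K (t ^ m) v = μ m • v := by
  suffices h : ∀ m, heckeOperator ρ K (t ^ m) v = μ m • v ∧ heckeOperator ρ K (t ^ (m + 1)) v = μ (m + 1) • v from (h m).1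
  intro m
  induction m with
  | zero =>
    refine ⟨by rw [pow_zero, heckeOperator_one_apply ρ K hv, h0, one_smul], by rw [zero_add, pow_one, hT, h1]⟩
  | succ m ih =>
    refine ⟨ih.2, ?_⟩
    have key := heckeOperator_pow_heckeOperator_apply ρ hfin hsymm hD hX hreg hv (m := m + 1) (by omega)
    rw [hT, map_smul, ih.2, Nat.add_sub_cancel, ih.1, smul_smul, smul_smul, smul_smul] at key
    -- `[K t^{m+2} K] v = (a₁ μ_{m+1} − c₀ μ_{m+1} − c μ_m) • v`
    have e : heckeOperator ρ K (t ^ (m + 1 + 1)) v =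
        (a₁ * μ (m + 1) - (c0 : k) * μ (m + 1) - ((if m + 1 = 1 then X.card else cup : ℕ) : k) * μ m) • v := by
      rw [sub_smul, sub_smul, key]; abel
    rw [show m + 1 + 1 = m + 2 by ring] at e
    rw [e]
    congr 1
    rcases Nat.eq_zero_or_pos m with rfl | hm
    · rw [if_pos rfl, h2, h1, h0]; ring
    · obtain ⟨n, rfl⟩ : ∃ n, m = n + 1 := ⟨m - 1, by omega⟩
      rw [if_neg (by omega), show n + 1 + 2 = n + 3 by ring, hrec n, show n + 1 + 1 = n + 2 by ring]; ring

/-- **THE OPERATOR RECURSION FOR A CONTRACTING TRANSVERSAL** — the binder list of ★ `SphericalCoefficient.ncard_translates_of_contracting`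
(`K_N ≤ K`, `t K_N t⁻¹ ≤ K_N`, `t⁻¹ ∈ KtK`, pairwise disjoint finite shells, `X = X₊ ∪ X₀ ∪ {t⁻¹}` a transversal of `KtK∕K` with `x t⁻¹ ∈ K_N`
on `X₊` and `t x t⁻¹ ∈ K_N` on `X₀`) plus `v ∈ V^K`, `[KtK] v = a₁ v` gives `[K tᵐ K] v = μ_m v` with `μ₀ = 1`, `μ₁ = a₁`,
`μ₂ = a₁² − |X₀| a₁ − (|X₊| + |X₀| + 1)`, `μ_{n+3} = (a₁ − |X₀|) μ_{n+2} − |X₊| μ_{n+1}` — for the hyperspecial vertex of an unramified rank-one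
group, `|X₊| = [K_N : tK_Nt⁻¹]`, `|X₀| + 1 = [L_1 : L_0]`. [cite: BruhatTits1972, (4.4.4)] [cite: Macdonald1971, Ch. V §3 (3.9)]
[cite: SerreTrees1980, II.1.1] -/
theorem heckeOperator_pow_apply_eq_smul_of_contracting [DecidableEq G] (hfin : ∀ n : ℕ, (orbit K ((t ^ n : G) : G ⧸ K)).Finite)
    {KN : Subgroup G} (hKN : KN ≤ K) (ht : ∀ u ∈ KN, t * u * t⁻¹ ∈ KN) (hsymm : t⁻¹ ∈ DoubleCoset.doubleCoset t (K : Set G) K)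
    (hD : ∀ m n : ℕ, m ≠ n → Disjoint (DoubleCoset.doubleCoset (t ^ m) (K : Set G) K) (DoubleCoset.doubleCoset (t ^ n) (K : Set G) K))
    {Xp X0 : Finset G} (hXp : ∀ x ∈ Xp, x * t⁻¹ ∈ KN) (hX0 : ∀ x ∈ X0, t * x * t⁻¹ ∈ KN)
    (hX : Set.BijOn (fun x : G => (x : G ⧸ K)) (Xp ∪ X0 ∪ {t⁻¹} : Finset G) (orbit K (t : G ⧸ K)))
    {v : V} (hv : v ∈ ρ.fixedPoints K) {a₁ : k} (hT : heckeOperator ρ K t v = a₁ • v)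
    (μ : ℕ → k) (h0 : μ 0 = 1) (h1 : μ 1 = a₁) (h2 : μ 2 = a₁ * a₁ - (X0.card : k) * a₁ - ((Xp.card : k) + X0.card + 1))
    (hrec : ∀ n, μ (n + 3) = (a₁ - X0.card) * μ (n + 2) - (Xp.card : k) * μ (n + 1)) (m : ℕ) :
    heckeOperator ρ K (t ^ m) v = μ m • v := by
  refine heckeOperator_pow_apply_eq_smul ρ hfin hsymm hD hX (cup := Xp.card) (c0 := X0.card)
    (fun n hn => ncard_translates_of_contracting hKN ht hD hXp hX0 hn) hv hT μ h0 h1 ?_ hrec m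
  rw [h2, card_contractingTransversal hKN ht hD hXp hX0]
  push_cast
  ring

end Operator

end Summit.HodgeConjecture.HodgeConjecture.Cruxes.HLiu418.K2LiuHeckeShellRecursion

end
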